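import Literature.Topology.FourManifolds.SphereCorePrimitive
import HarnessLib

/-!
# A torsion sphere class has a meridian of infinite order (the duality computation of
# Kervaire–Milnor 1963, p. 516, read for `⟨α, λ⟩ = 0`)

Topic `Literature/Topology/FourManifolds`; companion of `SphereCorePrimitive.lean` (Kervaire–Milnor,
*Groups of homotopy spheres I*, Ann. of Math. (2) 77 (1963), p. 516, proof of Lemma 5.7: by
Poincaré duality a class `λ` generating a free summand of `H_kM` is primitive). There the
computation "`μ₁ · λ = ⟨α, λ⟩`" of the image of a duality class `μ₁ = α ⌢ z` in
`H_{l+1}(M, M ∖ S) ≅ Ȟᵏ(S) ≅ ℤ` is used for `⟨α, λ⟩ = d ≠ 0`; this file records the complementary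
reading **`⟨α, λ⟩ = 0` for all `α`** (e.g. `λ` of finite order), needed for Kervaire–Milnor's
Lemma 5.8 (the parity of the `k`-th Betti number under a modification): then EVERY class of
`H_{l+1}(M)` has image `0` over the core, so the local class `α₀|_S ⌢ [X]_S` of a Čech class pairing to
`1` with `[S]` has boundary of infinite order in `H_l(M ∖ S)` — a class dying in `H_l(M)`.

* `FramedSphereFamily.exists_δ_not_isOfFinAddOrder_of_forall_dual_eq_zero` — for a framed sphere
  `ν : Sᵏ × ℝˡ⁺¹ ↪ W` (`k + l = n`, `k ≥ 2`) in a compact simply connected `(n+1)`-manifold with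
  boundary and a generator `θ` of `H_k(Sᵏ; ℤ)`: if `f((ν.sphereMap)⁎ θ) = 0` for every homomorphism
  `f : H_k(W; ℤ) → ℤ`, there is `y ∈ H_{l+1}(W, W ∖ S; ℤ)` with `∂y ∈ H_l(W ∖ S; ℤ)` of infinite order.
  (Lefschetz duality `bijective_relCapProduct_of_isRelFundamentalClass_holds` for the classes of
  `H_{l+1}(W)`, `FramedSphereFamily.concreteIso_map_incl_relCapProduct`,
  `FramedSphereFamily.kroneckerPairing_cechClass_eq`, `Cech.eq_zero_of_sphere`, Čech–Poincaré
  duality `HomologicalOrientation.bijective_cechCap_classAlong`; no hypothesis on `∂W`.)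

Everything is proved; no definitions, no named facts.

## References

* M. Kervaire, J. Milnor, *Groups of homotopy spheres I*, Ann. of Math. (2) 77 (1963), p. 516
  (proof of Lemma 5.7), Lemma 5.8. doi:10.2307/1970128 [KervaireMilnorAnnals1963]
* E. H. Spanier, *Algebraic Topology*, Springer 1981, Ch. 6 §1 Thm. 10, §3 Thm. 12. [Spanier1981]
* H. Miller, *Lectures on Algebraic Topology*, World Scientific 2020, Thm. 37.1. [Miller2020]
-/

noncomputable section

open scoped Manifold ContDiff Topology
open Set Function CategoryTheory CategoryTheory.Limits AddSubgroup Topology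
open Literature.AlgebraicTopology.SingularHomology

namespace Literature.Topology.FourManifolds

/-- Local notation: `𝔼 n` is the model Euclidean space `EuclideanSpace ℝ (Fin n)`. -/
local notation "𝔼 " n:arg => EuclideanSpace ℝ (Fin n)

/-- Local notation: `𝕊 n` is the unit sphere in `EuclideanSpace ℝ (Fin (n + 1))`. -/
local notation "𝕊 " n:arg => (Metric.sphere (0 : EuclideanSpace ℝ (Fin (n + 1))) 1)

namespace FramedSphereFamily

open ExtCollar

variable {n k l : ℕ} {W : Type} [TopologicalSpace W] [ChartedSpace (EuclideanHalfSpace (n + 1)) W]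
  (ν : FramedSphereFamily (𝓡∂ (n + 1)) W Unit k (l + 1))

/-- **Conversely, a torsion sphere class is "anti-primitive"** (the same duality computation read
for `⟨α, λ⟩ = 0`): if every homomorphism `f : H_k(W; ℤ) → ℤ` kills `λ = (ν.sphereMap)⁎ θ` (e.g. `λ`
has finite order), then `H_{l+1}(W) → H_{l+1}(W, W ∖ S)` is ZERO on… more precisely its cokernel
contains an element of infinite order: there is `y ∈ H_{l+1}(W, W ∖ S; ℤ)` whose boundary
`∂y ∈ H_l(W ∖ S; ℤ)` — a class dying in `H_l(W)` — has infinite order. (`y = α₀|_S ⌢ [X]_S` for a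
Čech class `α₀|_S` pairing to `1` with `[S]`; if `e • ∂y = 0` then `e • y = j⁎ μ`, `μ ↦ α ⌢ z` by
Lefschetz duality, whose image over the core is `⟨α, λ⟩ • (…) = 0`; so `e • y = 0` and `e = 0`.)
No hypothesis on `∂W` is needed here. [cite: KervaireMilnorAnnals1963, p. 516, proof of Lemma 5.7] [cite: Spanier1981, Ch. 6 Sec. 3 Thm. 12] -/
theorem exists_δ_not_isOfFinAddOrder_of_forall_dual_eq_zero [T2Space W] [CompactSpace W]
    [IsManifold (𝓡∂ (n + 1)) ∞ W] [SimplyConnectedSpace W] (hkl : k + l = n) (hk : 2 ≤ k)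
    {θ : singularHomology ℤ ℤ (𝕊 k) k} (hθ : zmultiples θ = ⊤)
    (htors : ∀ f : singularHomology ℤ ℤ W k →+ ℤ, f (singularHomology.map ℤ ℤ ν.sphereMap k θ) = 0) :
    ∃ y : relativeSingularHomology ℤ ℤ W (ν.complement : Set W) (l + 1),
      ¬ IsOfFinAddOrder (relativeSingularHomology.δ ℤ ℤ W (ν.complement : Set W) l y) := by
  classical
  have hdeg : k + (l + 1) = n + 1 := by omega
  have hk1 : 1 ≤ k := by omega
  have hS'c : IsCompact (incl n '' ν.cores : Set (ExtCollar n W)) := ν.isCompact_cores.image continuous_incl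
  obtain ⟨z, hz⟩ := exists_isRelFundamentalClass_of_simplyConnectedSpace n W
  set jS := relativeSingularHomology.map ℤ ℤ (ContinuousMap.id W) (ν.mapsTo_id_boundary_compl_cores hkl)
    (l + 1) with hjS
  set E := relativeSingularHomology.map ℤ ℤ (inclCM n) ν.mapsTo_incl_compl_cores (l + 1) with hE
  haveI : IsIso E := ν.isIso_map_incl_compl_cores hkl (l + 1)
  set cI := relativeSingularHomology.concreteIso ℤ ℤ (ExtCollar n W) (incl n '' ν.cores)ᶜ (l + 1) with hcI
  obtain ⟨T⟩ := ν.nonempty_retractionNhds_image_cores hkl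
  obtain ⟨e, he⟩ := ν.exists_homeomorph_sphere_image_cores (n := n)
  let L : Cech ℤ (ModuleCat.of ℤ (ULift.{0} ℤ)) (incl n '' ν.cores : Set (ExtCollar n W)) k → ℤ :=
    fun b => kroneckerPairing ℤ ℤ (𝕊 k) k (singularCohomology.map ℤ ℤ
      (e : C(𝕊 k, ↥(incl n '' ν.cores))) k (Cech.toSingularCohomology ℤ (incl n '' ν.cores) k b)) θ
  have hL : ∀ b, L b = kroneckerPairing ℤ ℤ (𝕊 k) k (singularCohomology.map ℤ ℤ
      (e : C(𝕊 k, ↥(incl n '' ν.cores))) k (Cech.toSingularCohomology ℤ (incl n '' ν.cores) k b)) θ :=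
    fun b => rfl
  have hLadd : ∀ (m : ℕ) (b), L (m • b) = m * L b := by
    intro m b
    simp only [hL, map_nsmul, LinearMap.smul_apply, nsmul_eq_mul]
  -- a Čech class `b₀` of the core pairing to `1`: from `γ ∈ Hᵏ(Sᵏ)` with `⟨γ, θ⟩ = 1`
  obtain ⟨γ, hγ⟩ : ∃ γ : singularCohomology ℤ ℤ (𝕊 k) k, kroneckerPairing ℤ ℤ (𝕊 k) k γ θ = 1 := by
    obtain ⟨eS⟩ := nonempty_singularHomology_sphere_iso_holds ℤ ℤ (n := k) hk1
    -- `eS θ` generates `ULift ℤ`, so `eS θ = ±1`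
    obtain ⟨m, hm⟩ := mem_zmultiples_iff.1 (hθ.symm ▸ mem_top (eS.inv ⟨1⟩) : eS.inv ⟨1⟩ ∈ zmultiples θ)
    have hm1 : m * (eS.hom θ).down = 1 := by
      have := congrArg (fun x => (eS.hom x).down) hm
      simp only [map_zsmul] at this
      rw [← ModuleCat.comp_apply, eS.inv_hom_id, ModuleCat.id_apply] at this
      simpa using this
    let g : singularHomology ℤ ℤ (𝕊 k) k →ₗ[ℤ] ℤ :=
      (m • (ULift.moduleEquiv.toLinearMap)) ∘ₗ eS.hom.hom
    obtain ⟨γ, hγ⟩ := kroneckerPairing_surjective ℤ (𝕊 k) k g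
    refine ⟨γ, ?_⟩
    rw [hγ]
    change m • (eS.hom θ).down = 1
    rw [smul_eq_mul, hm1]
  obtain ⟨b₀, hb₀⟩ := (T.bijective_toSingularCohomology (R := ℤ) k).2
    (singularCohomology.map ℤ ℤ (e.symm : C(↥(incl n '' ν.cores : Set (ExtCollar n W)), 𝕊 k)) k γ)
  have hLb₀ : L b₀ = 1 := by
    rw [hL, hb₀, ← ModuleCat.comp_apply, ← singularCohomology.map_comp]
    have : (e.symm : C(↥(incl n '' ν.cores : Set (ExtCollar n W)), 𝕊 k)).comp
        (e : C(𝕊 k, ↥(incl n '' ν.cores))) = ContinuousMap.id _ := by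
      ext u : 1
      exact e.symm_apply_apply u
    rw [this, singularCohomology.map_id, ModuleCat.id_apply]
    exact hγ
  -- `y₀ = E⁻¹ cI⁻¹ (b₀ ⌢ [X]_S)`
  set c₀ := cechCap hS'c.isClosed hdeg
    (HomologicalOrientation.classAlong (Nat.le_add_left 1 n) (ExtCollar.orientation z hz) hS'c) b₀ with hc₀
  set y₀ : relativeSingularHomology ℤ ℤ W ν.coresᶜ (l + 1) := inv E (cI.inv c₀) with hy₀
  have hEy₀ : cI.hom (E y₀) = c₀ := by
    have h1 : E y₀ = cI.inv c₀ := by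
      rw [hy₀, ← ModuleCat.comp_apply, IsIso.inv_hom_id, ModuleCat.id_apply]
    rw [h1, Iso.inv_hom_id_apply]
  refine ⟨y₀, fun hfin => ?_⟩
  obtain ⟨m, hm, hmy⟩ := hfin.exists_nsmul_eq_zero
  -- `m • y₀` lifts to `H_{l+1}(W)`
  have hex := (ShortComplex.moduleCat_exact_iff _).1
    (relativeSingularHomology.exact_ofAbsolute_δ ℤ ℤ (ν.coresᶜ : Set W) l)
  obtain ⟨μ, hμ⟩ := hex (m • y₀) (by
    change relativeSingularHomology.δ ℤ ℤ W ν.coresᶜ l (m • y₀) = 0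
    rw [map_nsmul]; exact hmy)
  -- `j⁎ μ = j_S (α ⌢ z)` for some `α` (Lefschetz duality), and its image over the core vanishes
  obtain ⟨α, hα⟩ := (bijective_relCapProduct_of_isRelFundamentalClass_holds n W z hz hdeg).2
    (relativeSingularHomology.ofAbsolute ℤ ℤ W ((𝓡∂ (n + 1)).boundary W) (l + 1) μ)
  have hαθ : kroneckerPairing ℤ ℤ W k α (singularHomology.map ℤ ℤ ν.sphereMap k θ) = 0 :=
    htors (kroneckerPairing ℤ ℤ W k α).toAddMonoidHom
  set aS : Cech ℤ (ModuleCat.of ℤ (ULift.{0} ℤ)) (incl n '' ν.cores : Set (ExtCollar n W)) k :=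
    Cech.of ℤ (SimplexSpan.coefR ℤ) (OpenNhd.univ (incl n '' ν.cores))
      (subsetCochains.thetaInv k (singularCohomology.map ℤ ℤ baseCM k α)) with haS
  have haS0 : aS = 0 :=
    Literature.Topology.FourManifolds.Cech.eq_zero_of_sphere T hk e hθ L hL
      (by rw [hL, haS, ν.kroneckerPairing_cechClass_eq e he α θ]; exact hαθ)
  have hzero : cI.hom (E (m • y₀)) = 0 := by
    have h1 : m • y₀ = jS (relCapProduct (M := ℤ) ((𝓡∂ (n + 1)).boundary W) hdeg α z) := by
      have h2 : (m • y₀ : relativeSingularHomology ℤ ℤ W ν.coresᶜ (l + 1)) =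
          (relativeSingularHomology.ofAbsolute ℤ ℤ W ((𝓡∂ (n + 1)).boundary W) (l + 1) ≫ jS) μ := by
        rw [← hμ, hjS, relativeSingularHomology.ofAbsolute_comp_map, singularHomology.map_id]
        rfl
      rw [h2, ModuleCat.comp_apply]
      exact congrArg jS hα.symm
    rw [h1, ν.concreteIso_map_incl_relCapProduct hkl hdeg z hz α, ← haS, haS0, map_zero]
  -- hence `m • c₀ = 0`, `m • b₀ = 0`, `m = m • L b₀ = 0`
  have hc : (m : ℤ) • c₀ = 0 := by
    have h1 : cI.hom (E ((m : ℤ) • y₀)) = 0 := by rw [natCast_zsmul]; exact hzero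
    rwa [map_zsmul, map_zsmul, hEy₀] at h1
  have hb : (m : ℤ) • b₀ = 0 :=
    (HomologicalOrientation.bijective_cechCap_classAlong (Nat.le_add_left 1 n)
      (ExtCollar.orientation z hz) hS'c hdeg).1 (by rw [map_zsmul, map_zero]; exact hc)
  have : (m : ℤ) = 0 := by
    have h := congrArg L hb
    rw [natCast_zsmul, hLadd, hLb₀, mul_one] at h
    rw [h, hL, map_zero, map_zero, map_zero, LinearMap.zero_apply]
  omega

end FramedSphereFamily

end Literature.Topology.FourManifolds

end
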